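import Mathlib.Analysis.Complex.CauchyIntegral
import Mathlib.Analysis.SpecialFunctions.Pow.Deriv
import Mathlib.Analysis.Normed.Group.FunctionSeries
import Mathlib.Analysis.Normed.Ring.InfiniteSum
import Mathlib.LinearAlgebra.Matrix.Block
import Literature.Probability.LatticeModels.OnsagerToeplitz
import HarnessLib

/-!
# Wu's exponential decay of the Toeplitz determinants of Onsager's symbol above `T_c` — proof

Topic `Probability/LatticeModels`, namespace `Literature.Probability.LatticeModels`. Sibling of
`OnsagerToeplitz.lean` (and of `OnsagerToeplitzProofs.lean`, which discharges the other
exact-solution fact `torusRowPair_tendsto_toeplitzDet`; the two are combined in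
`OnsagerYangFromSzego.lean`); discharges the named fact
`Literature.Probability.LatticeModels.toeplitzDet_onsagerSymbol_exp_decay` (T. T. Wu, Phys. Rev.
149 (1966) 380, the `T > T_c` asymptotics of `D_n(φ_Onsager)`, recorded in Deift–Its–Krasovsky,
CPAM 66 (2013), §5, eq. (64), in the weak form `|D_k(φ_β)| ≤ C e^{-ck}` for `0 < β < β_c(2)`).

## The proof

For `0 < β < β_c(2)` one has `0 < γ₁ < 1 < γ₂` and Onsager's symbol factors as
`φ_β(e^{iθ}) = -e^{-iθ} h(e^{iθ}) g(e^{-iθ})`, `h(z) = (1-γ₁z)^{1/2}(1-z/γ₂)^{1/2}`, `g = 1/h`,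
with `h`, `g` analytic on a disc of radius `R > 1` (a symbol of winding number `-1`, DIK §5). Write
`h(z) = ∑ sₓ zˣ`, `g(z) = ∑ p_y z^y` (`|sₓ|, |p_y| ≤ C R^{-x}`, Cauchy estimates). Multiplying
`T_n(φ_β)` on the left by the upper unitriangular Toeplitz matrix `(s_{l-j})` and on the right by the
lower unitriangular `(p_{m-k})` does not change the determinant and produces `-S + K`, where `S` is
the shift `S_{j,j+1} = 1` and `|K_{jk}| ≤ K₀ R^{-(n-j)-(n-k)}` (orthogonality of the exponentials:
only the tails of the two series contribute). The bound `|det M| ≤ ∏_k ∑_j |M_{jk}|` then gives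
`|D_n(φ_β)| ≤ C' R^{-n}`: column `0` of `-S + K` has sum `O(R^{-n})`, the others `1 + O(R^{-(n-k)})`.
This is the classical mechanism behind `D_n(z^{-1}b) → 0` for zero-winding `b`
(Böttcher–Silbermann, *Introduction to large truncated Toeplitz matrices*, §2.6 / §10); no
Wiener–Hopf theory is needed for the explicit symbol at hand.

## Contents

* `norm_det_le_prod_colSum` — `‖det A‖ ≤ ∏_k ∑_j ‖A_{jk}‖`;
* `exists_hasSum_of_differentiableOn_closedBall` — Taylor expansion on the closed unit disc of a
  function holomorphic on a larger disc, with geometric coefficient bounds (Cauchy estimates);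
* `integral_exp_mul_tsum_mul_tsum_eq_zero` — orthogonality for products of absolutely convergent
  trigonometric series;
* `toeplitzDet_exp_decay_of_factorization` — the abstract decay theorem for a symbol
  `φ = -e^{-iθ} (∑ sₓ e^{ixθ}) (∑ p_y e^{-iyθ})` with `(∑ sₓ e^{ixθ})(∑ p_y e^{iyθ}) = 1`;
* `onsagerSymbol_eq_factorization` and `toeplitzDet_onsagerSymbol_exp_decay_holds`.

## References

* T. T. Wu, Phys. Rev. 149 (1966) 380–401 (the `T > T_c` asymptotics, eq. (64) of DIK).
* P. Deift, A. Its, I. Krasovsky, Comm. Pure Appl. Math. 66 (2013) 1360–1438, §§2, 5.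
* A. Böttcher, B. Silbermann, *Introduction to large truncated Toeplitz matrices*, Springer 1999.
-/

noncomputable section

open Filter Complex MeasureTheory intervalIntegral Finset
open scoped _root_.Topology

namespace Literature.Probability.LatticeModels

open Literature.Analysis.Toeplitz

/-! ### A determinant bound: `‖det A‖ ≤ ∏_k ∑_j ‖A_{jk}‖` -/

/-- **Column-sum bound for determinants**: `‖det A‖ ≤ ∏_k ∑_j ‖A_{jk}‖` (the product expands into
a sum over all maps containing every permutation term of the Leibniz formula, with nonnegative
terms). [folklore] -/
theorem norm_det_le_prod_colSum {n : Type*} [Fintype n] [DecidableEq n] (A : Matrix n n ℂ) :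
    ‖A.det‖ ≤ ∏ k, ∑ j, ‖A j k‖ := by
  rw [Matrix.det_apply', Finset.prod_univ_sum]
  calc ‖∑ σ : Equiv.Perm n, ((Equiv.Perm.sign σ : ℤ) : ℂ) * ∏ i, A (σ i) i‖
      ≤ ∑ σ : Equiv.Perm n, ‖((Equiv.Perm.sign σ : ℤ) : ℂ) * ∏ i, A (σ i) i‖ := norm_sum_le _ _
    _ = ∑ σ : Equiv.Perm n, ∏ i, ‖A (σ i) i‖ := by
        refine Finset.sum_congr rfl fun σ _ => ?_
        rw [norm_mul, norm_prod]
        rcases Int.units_eq_one_or (Equiv.Perm.sign σ) with h | h <;> simp [h]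
    _ = ∑ p ∈ (Finset.univ : Finset (Equiv.Perm n)).map ⟨fun σ : Equiv.Perm n => (σ : n → n),
          fun σ τ h => Equiv.ext (congrFun h)⟩, ∏ i, ‖A (p i) i‖ := by
        rw [Finset.sum_map]
        rfl
    _ ≤ ∑ p ∈ Fintype.piFinset fun _ : n => (Finset.univ : Finset n), ∏ i, ‖A (p i) i‖ := by
        refine Finset.sum_le_sum_of_subset_of_nonneg (fun p _ => ?_) fun p _ _ =>
          Finset.prod_nonneg fun i _ => norm_nonneg _
        simp

/-! ### Geometric tails -/

section Tails

variable {a : ℕ → ℂ} {C σ : ℝ}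

/-- `C ≥ 0` as soon as `‖a 0‖ ≤ C σ⁰`. [folklore] -/
theorem nonneg_of_norm_le_geom (ha : ∀ x, ‖a x‖ ≤ C * σ ^ x) : 0 ≤ C := by
  simpa using (norm_nonneg (a 0)).trans (ha 0)

/-- A geometrically bounded sequence is absolutely summable, also after a shift and after
multiplication by unimodular weights. [folklore] -/
theorem summable_norm_shift_mul (hσ0 : 0 ≤ σ) (hσ1 : σ < 1) (ha : ∀ x, ‖a x‖ ≤ C * σ ^ x)
    (N : ℕ) {u : ℕ → ℂ} (hu : ∀ x, ‖u x‖ ≤ 1) :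
    Summable fun x => ‖a (x + N) * u x‖ := by
  have hC := nonneg_of_norm_le_geom ha
  refine Summable.of_nonneg_of_le (fun _ => norm_nonneg _) (fun x => ?_)
    (((summable_geometric_of_lt_one hσ0 hσ1).mul_left (C * σ ^ N)))
  calc ‖a (x + N) * u x‖ = ‖a (x + N)‖ * ‖u x‖ := norm_mul _ _
    _ ≤ C * σ ^ (x + N) * 1 := mul_le_mul (ha _) (hu x) (norm_nonneg _) (by positivity)
    _ = C * σ ^ N * σ ^ x := by rw [pow_add]; ring

/-- **Tail bound**: `‖∑_{x} a_{x+N} u_x‖ ≤ C σ^N / (1 - σ)` for unimodular weights `u`. [folklore] -/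
theorem norm_tsum_shift_mul_le (hσ0 : 0 ≤ σ) (hσ1 : σ < 1) (ha : ∀ x, ‖a x‖ ≤ C * σ ^ x)
    (N : ℕ) {u : ℕ → ℂ} (hu : ∀ x, ‖u x‖ ≤ 1) :
    ‖∑' x, a (x + N) * u x‖ ≤ C * σ ^ N / (1 - σ) := by
  have hC := nonneg_of_norm_le_geom ha
  have hs := summable_norm_shift_mul hσ0 hσ1 ha N hu
  have hg := (summable_geometric_of_lt_one hσ0 hσ1).mul_left (C * σ ^ N)
  calc ‖∑' x, a (x + N) * u x‖ ≤ ∑' x, ‖a (x + N) * u x‖ := norm_tsum_le_tsum_norm hs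
    _ ≤ ∑' x, C * σ ^ N * σ ^ x := by
        refine hs.tsum_le_tsum (fun x => ?_) hg
        calc ‖a (x + N) * u x‖ = ‖a (x + N)‖ * ‖u x‖ := norm_mul _ _
          _ ≤ C * σ ^ (x + N) * 1 := mul_le_mul (ha _) (hu x) (norm_nonneg _) (by positivity)
          _ = C * σ ^ N * σ ^ x := by rw [pow_add]; ring
    _ = C * σ ^ N / (1 - σ) := by
        rw [tsum_mul_left, tsum_geometric_of_lt_one hσ0 hσ1, div_eq_mul_inv]

/-- `‖e^{z}‖ = 1` for `z` purely imaginary. [folklore] -/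
theorem norm_exp_of_re_eq_zero {z : ℂ} (hz : z.re = 0) : ‖Complex.exp z‖ = 1 := by
  rw [Complex.norm_exp, hz, Real.exp_zero]

end Tails

/-! ### Orthogonality for products of absolutely convergent trigonometric series -/

/-- One term: `∫_{-π}^{π} e^{irθ} (a e^{ie₁θ}) (b e^{ie₂θ}) dθ = 0` if `e₁ + e₂ + r ≠ 0`. [folklore] -/
theorem integral_exp_mul_term_eq_zero (a b : ℂ) {e₁ e₂ r : ℤ} (h : e₁ + e₂ + r ≠ 0) :
    (∫ θ in (-Real.pi)..Real.pi, Complex.exp ((r : ℂ) * θ * I) *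
        (a * Complex.exp ((e₁ : ℂ) * θ * I) * (b * Complex.exp ((e₂ : ℂ) * θ * I)))) = 0 := by
  have hfun : (fun θ : ℝ => Complex.exp ((r : ℂ) * θ * I) *
      (a * Complex.exp ((e₁ : ℂ) * θ * I) * (b * Complex.exp ((e₂ : ℂ) * θ * I)))) =
      fun θ : ℝ => a * b * Complex.exp (((e₁ + e₂ + r : ℤ) : ℂ) * θ * I) := by
    funext θ
    rw [show ((e₁ + e₂ + r : ℤ) : ℂ) * θ * I =
        (e₁ : ℂ) * θ * I + (e₂ : ℂ) * θ * I + (r : ℂ) * θ * I by push_cast; ring,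
      Complex.exp_add, Complex.exp_add]
    ring
  rw [hfun, intervalIntegral.integral_const_mul, integral_exp_int_mul_I, if_neg h, mul_zero]

/-- The norm of a term `a e^{ieθ}` is `‖a‖`. [folklore] -/
theorem norm_mul_exp_int_mul (a : ℂ) (e : ℤ) (θ : ℝ) :
    ‖a * Complex.exp ((e : ℂ) * θ * I)‖ = ‖a‖ := by
  rw [norm_mul, norm_exp_of_re_eq_zero (by simp), mul_one]

/-- **Orthogonality for double series.** If `∑ |aₓ| < ∞`, `∑ |b_y| < ∞` and no pair of
frequencies satisfies `e₁(x) + e₂(y) + r = 0`, then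
`∫_{-π}^{π} e^{irθ} (∑ₓ aₓ e^{ie₁(x)θ}) (∑_y b_y e^{ie₂(y)θ}) dθ = 0` (expand the product as an
absolutely convergent double series and integrate termwise by dominated convergence). [folklore] -/
theorem integral_exp_mul_tsum_mul_tsum_eq_zero {a b : ℕ → ℂ} (ha : Summable fun x => ‖a x‖)
    (hb : Summable fun y => ‖b y‖) (e₁ e₂ : ℕ → ℤ) (r : ℤ)
    (h : ∀ x y, e₁ x + e₂ y + r ≠ 0) :
    (∫ θ in (-Real.pi)..Real.pi, Complex.exp ((r : ℂ) * θ * I) *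
        ((∑' x, a x * Complex.exp ((e₁ x : ℂ) * θ * I)) *
          ∑' y, b y * Complex.exp ((e₂ y : ℂ) * θ * I))) = 0 := by
  obtain ⟨F, hF⟩ : ∃ F : ℕ × ℕ → ℝ → ℂ, F = fun (z : ℕ × ℕ) (θ : ℝ) => Complex.exp ((r : ℂ) * θ * I) *
      (a z.1 * Complex.exp ((e₁ z.1 : ℂ) * θ * I) * (b z.2 * Complex.exp ((e₂ z.2 : ℂ) * θ * I))) :=
    ⟨_, rfl⟩
  -- pointwise: the integrand is the sum of the double family
  have hsum : ∀ θ : ℝ, HasSum (fun z => F z θ) (Complex.exp ((r : ℂ) * θ * I) *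
      ((∑' x, a x * Complex.exp ((e₁ x : ℂ) * θ * I)) *
        ∑' y, b y * Complex.exp ((e₂ y : ℂ) * θ * I))) := by
    intro θ
    have h1 : Summable fun x => ‖a x * Complex.exp ((e₁ x : ℂ) * θ * I)‖ := by
      simpa only [norm_mul_exp_int_mul] using ha
    have h2 : Summable fun y => ‖b y * Complex.exp ((e₂ y : ℂ) * θ * I)‖ := by
      simpa only [norm_mul_exp_int_mul] using hb
    have hA := h1.of_norm.hasSum
    have hB := h2.of_norm.hasSum
    have hC := summable_mul_of_summable_norm h1 h2
    have hprod := (hA.mul hB hC).mul_left (Complex.exp ((r : ℂ) * θ * I))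
    rw [hF]
    exact hprod
  -- termwise integration
  have hint : HasSum (fun z => ∫ θ in (-Real.pi)..Real.pi, F z θ)
      (∫ θ in (-Real.pi)..Real.pi, Complex.exp ((r : ℂ) * θ * I) *
        ((∑' x, a x * Complex.exp ((e₁ x : ℂ) * θ * I)) *
          ∑' y, b y * Complex.exp ((e₂ y : ℂ) * θ * I))) := by
    refine intervalIntegral.hasSum_integral_of_dominated_convergence
      (fun z _ => ‖a z.1‖ * ‖b z.2‖) (fun z => ?_) (fun z => ?_) ?_ ?_ ?_
    · rw [hF]
      exact Continuous.aestronglyMeasurable (by fun_prop)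
    · refine Filter.Eventually.of_forall fun θ _ => ?_
      rw [hF]
      dsimp only
      rw [norm_mul, norm_exp_of_re_eq_zero (by simp), one_mul, norm_mul, norm_mul_exp_int_mul,
        norm_mul_exp_int_mul]
    · exact Filter.Eventually.of_forall fun θ _ =>
        ha.mul_of_nonneg hb (fun _ => norm_nonneg _) fun _ => norm_nonneg _
    · exact intervalIntegrable_const
    · exact Filter.Eventually.of_forall fun θ _ => hsum θ
  -- each term integrates to zero
  have hzero : (fun z => ∫ θ in (-Real.pi)..Real.pi, F z θ) = fun _ => 0 := by
    funext z
    rw [hF]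
    exact integral_exp_mul_term_eq_zero (a z.1) (b z.2) (h z.1 z.2)
  rw [hzero] at hint
  exact (hasSum_zero.unique hint).symm

/-! ### Taylor expansion on the unit circle of a function holomorphic on a larger disc -/

/-- **Cauchy estimates on the closed unit disc.** If `f` is complex differentiable on the closed
disc `|z| ≤ R`, `R > 1`, then `f(w) = ∑ qₙ wⁿ` for `|w| ≤ 1` with `q₀ = f(0)` and
`|qₙ| ≤ C R^{-n}` (the Cauchy integral formula for the Taylor coefficients). [folklore] -/
theorem exists_hasSum_of_differentiableOn_closedBall {f : ℂ → ℂ} {R : ℝ} (hR : 1 < R)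
    (hf : DifferentiableOn ℂ f (Metric.closedBall 0 R)) :
    ∃ q : ℕ → ℂ, ∃ C : ℝ, q 0 = f 0 ∧ (∀ n, ‖q n‖ ≤ C * R⁻¹ ^ n) ∧
      ∀ w : ℂ, ‖w‖ ≤ 1 → HasSum (fun n => q n * w ^ n) (f w) := by
  have hR0 : 0 < R := one_pos.trans hR
  lift R to NNReal using hR0.le
  have hRpos : (0 : NNReal) < R := by exact_mod_cast hR0
  have hps := hf.hasFPowerSeriesOnBall hRpos
  refine ⟨fun n => cauchyPowerSeries f 0 R n fun _ => 1,
    (2 * Real.pi)⁻¹ * ∫ θ : ℝ in (0)..2 * Real.pi, ‖f (circleMap 0 R θ)‖, ?_, fun n => ?_,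
    fun w hw => ?_⟩
  · simpa using hps.coeff_zero fun _ => 1
  · calc ‖cauchyPowerSeries f 0 R n fun _ => 1‖
        ≤ ‖cauchyPowerSeries f 0 R n‖ * ∏ _i : Fin n, ‖(1 : ℂ)‖ :=
          ContinuousMultilinearMap.le_opNorm _ _
      _ = ‖cauchyPowerSeries f 0 R n‖ := by simp
      _ ≤ ((2 * Real.pi)⁻¹ * ∫ θ : ℝ in (0)..2 * Real.pi, ‖f (circleMap 0 R θ)‖) * |(R : ℝ)|⁻¹ ^ n :=
          norm_cauchyPowerSeries_le f 0 R n
      _ = ((2 * Real.pi)⁻¹ * ∫ θ : ℝ in (0)..2 * Real.pi, ‖f (circleMap 0 R θ)‖) * (R : ℝ)⁻¹ ^ n := by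
          rw [abs_of_pos hR0]
  · have hwball : w ∈ Metric.eball (0 : ℂ) R := by
      rw [Metric.eball_coe, Metric.mem_ball, dist_zero_right]
      exact lt_of_le_of_lt hw (by exact_mod_cast hR)
    have h := hps.hasSum hwball
    rw [zero_add] at h
    refine h.congr_fun fun n => ?_
    have := (cauchyPowerSeries f 0 R n).map_smul_univ (fun _ : Fin n => w) fun _ => 1
    simp only [smul_eq_mul, mul_one, Fin.prod_const] at this
    dsimp only
    rw [this, mul_comm]

/-! ### The abstract decay theorem: triangular multipliers -/

section Abstract

variable {s p : ℕ → ℂ} {C σ : ℝ}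

/-- Reindexing a truncated one-sided convolution against a multiplicative weight:
`∑_{l<n} [j ≤ l] s_{l-j} u_l = u_j ∑_{x<n-j} s_x u_x`. [folklore] -/
theorem sum_ite_le_mul_eq (s : ℕ → ℂ) {u : ℕ → ℂ} (hu : ∀ a b, u (a + b) = u a * u b) {j n : ℕ}
    (hj : j ≤ n) :
    ∑ l ∈ range n, (if j ≤ l then s (l - j) else 0) * u l =
      u j * ∑ x ∈ range (n - j), s x * u x := by
  rw [← Finset.sum_range_add_sum_Ico _ hj, Finset.sum_eq_zero (fun l hl => ?_), zero_add,
    Finset.sum_Ico_eq_sum_range, Finset.mul_sum]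
  · refine Finset.sum_congr rfl fun x _ => ?_
    rw [if_pos (Nat.le_add_right j x), Nat.add_sub_cancel_left, hu]
    ring
  · rw [if_neg (not_le.2 (Finset.mem_range.1 hl)), zero_mul]

/-- The weight `l ↦ e^{-ilθ}` is multiplicative. [folklore] -/
theorem exp_neg_nat_add_mul (θ : ℝ) (a b : ℕ) :
    Complex.exp (-(((a + b : ℕ) : ℂ) * θ * I)) =
      Complex.exp (-((a : ℂ) * θ * I)) * Complex.exp (-((b : ℂ) * θ * I)) := by
  rw [← Complex.exp_add]; congr 1; push_cast; ring

/-- The weight `l ↦ e^{ilθ}` is multiplicative. [folklore] -/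
theorem exp_nat_add_mul (θ : ℝ) (a b : ℕ) :
    Complex.exp (((a + b : ℕ) : ℂ) * θ * I) =
      Complex.exp ((a : ℂ) * θ * I) * Complex.exp ((b : ℂ) * θ * I) := by
  rw [← Complex.exp_add]; congr 1; push_cast; ring

/-- **The algebra of the multiplier trick.** With `S⁺G⁺ = 1`, `S⁻G⁻ = 1` and
`φ = -E S⁺ G⁻`, the integrand `φ · (E_j (S⁻ - R⁻)) · (E_k (G⁺ - R⁺))` splits into the shift term
`-E E_j E_k`, two cross terms carrying one tail each, and a term carrying both tails. [folklore] -/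
theorem integrand_identity {φθ E Ej Ek Sp Sm Gp Gm Rm Rp : ℂ} (h1 : Sp * Gp = 1)
    (h2 : Sm * Gm = 1) (hφ : φθ = -E * Sp * Gm) :
    φθ * (Ej * (Sm - Rm)) * (Ek * (Gp - Rp)) =
      -(E * Ej * Ek) + E * Ej * Ek * (Sp * Rp) + E * Ej * Ek * (Gm * Rm) +
        φθ * Ej * Ek * (Rm * Rp) := by
  subst hφ
  linear_combination (-(E * Ej * Ek) * (Sm * Gm - Gm * Rm)) * h1 +
    (-(E * Ej * Ek) * (1 - Sp * Rp)) * h2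

/-- The shift term: `∫_{-π}^{π} -(e^{-iθ} e^{-ijθ} e^{ikθ}) dθ = -2π [k = j+1]`. [folklore] -/
theorem integral_shift_term (j k : ℕ) :
    (∫ θ in (-Real.pi)..Real.pi, -(Complex.exp (-(θ * I)) * Complex.exp (-((j : ℂ) * θ * I)) *
        Complex.exp ((k : ℂ) * θ * I))) =
      -(if k = j + 1 then 2 * (Real.pi : ℂ) else 0) := by
  have hfun : (fun θ : ℝ => -(Complex.exp (-(θ * I)) * Complex.exp (-((j : ℂ) * θ * I)) *
      Complex.exp ((k : ℂ) * θ * I))) =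
      fun θ : ℝ => -Complex.exp ((((k : ℤ) - j - 1 : ℤ) : ℂ) * θ * I) := by
    funext θ
    rw [← Complex.exp_add, ← Complex.exp_add]
    congr 2
    push_cast
    ring
  rw [hfun, intervalIntegral.integral_neg, integral_exp_int_mul_I]
  by_cases hkj : k = j + 1
  · rw [if_pos hkj, if_pos (by omega)]
  · rw [if_neg hkj, if_neg (by omega)]

/-- `e^{-iθ} e^{-ijθ} e^{ikθ} = e^{i(k-j-1)θ}`. [folklore] -/
theorem exp_shift_eq (θ : ℝ) (j k : ℕ) :
    Complex.exp (-(θ * I)) * Complex.exp (-((j : ℂ) * θ * I)) * Complex.exp ((k : ℂ) * θ * I) =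
      Complex.exp ((((k : ℤ) - j - 1 : ℤ) : ℂ) * θ * I) := by
  rw [← Complex.exp_add, ← Complex.exp_add]
  congr 1
  push_cast
  ring

/-- Absolute summability of the series `∑ a_x u_x` for a geometrically bounded `a` and unimodular
weights. [folklore] -/
theorem summable_norm_mul_of_geom {a : ℕ → ℂ} (hσ0 : 0 ≤ σ) (hσ1 : σ < 1)
    (ha : ∀ x, ‖a x‖ ≤ C * σ ^ x) {u : ℕ → ℂ} (hu : ∀ x, ‖u x‖ ≤ 1) :
    Summable fun x => ‖a x * u x‖ := by
  simpa using summable_norm_shift_mul hσ0 hσ1 ha 0 hu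

/-- Sup bound for the full series: `‖∑ a_x u_x‖ ≤ C/(1-σ)`. [folklore] -/
theorem norm_tsum_mul_le_of_geom {a : ℕ → ℂ} (hσ0 : 0 ≤ σ) (hσ1 : σ < 1)
    (ha : ∀ x, ‖a x‖ ≤ C * σ ^ x) {u : ℕ → ℂ} (hu : ∀ x, ‖u x‖ ≤ 1) :
    ‖∑' x, a x * u x‖ ≤ C / (1 - σ) := by
  simpa using norm_tsum_shift_mul_le hσ0 hσ1 ha 0 hu

/-- The weights `e^{±ixθ}` (natural frequencies) are unimodular. [folklore] -/
theorem norm_exp_nat_le (x : ℕ) (θ : ℝ) : ‖Complex.exp ((x : ℂ) * θ * I)‖ ≤ 1 :=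
  (norm_exp_of_re_eq_zero (by simp)).le

/-- The weights `e^{-ixθ}` are unimodular. [folklore] -/
theorem norm_exp_neg_nat_le (x : ℕ) (θ : ℝ) : ‖Complex.exp (-((x : ℂ) * θ * I))‖ ≤ 1 :=
  (norm_exp_of_re_eq_zero (by simp)).le

/-- **The first cross term** `∫ e^{i(k-j-1)θ} S⁺(θ) R⁺_{n-k}(θ) dθ`: it vanishes unless `j = n-1`
(all frequencies are `≥ n-k > k-j-1`), and is always bounded through the tail; altogether
`≤ 2π C² σ^{(n-j)+(n-k)} / ((1-σ)² σ)`. [folklore] -/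
theorem norm_integral_cross_pos_le (hσ0 : 0 < σ) (hσ1 : σ < 1) (hs : ∀ x, ‖s x‖ ≤ C * σ ^ x)
    (hp : ∀ y, ‖p y‖ ≤ C * σ ^ y) {n j k : ℕ} (hj : j < n) (hk : k < n) :
    ‖∫ θ in (-Real.pi)..Real.pi, Complex.exp ((((k : ℤ) - j - 1 : ℤ) : ℂ) * θ * I) *
        ((∑' x, s x * Complex.exp ((x : ℂ) * θ * I)) *
          ∑' y, p (y + (n - k)) * Complex.exp (((y + (n - k) : ℕ) : ℂ) * θ * I))‖ ≤
      2 * Real.pi * C ^ 2 / ((1 - σ) ^ 2 * σ) * σ ^ ((n - j) + (n - k)) := by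
  have hC := nonneg_of_norm_le_geom hs
  rcases lt_or_eq_of_le (Nat.succ_le_of_lt hj) with hlt | heq
  · -- `j + 1 < n`: orthogonality
    have h0 := integral_exp_mul_tsum_mul_tsum_eq_zero
      (summable_norm_mul_of_geom hσ0.le hσ1 hs (u := fun _ => 1) (by simp))
      (summable_norm_shift_mul hσ0.le hσ1 hp (n - k) (u := fun _ => 1) (by simp))
      (fun x => (x : ℤ)) (fun y => (y : ℤ) + (n - k : ℕ)) ((k : ℤ) - j - 1)
      (fun x y => by omega)
    simp only [mul_one, Int.cast_natCast, Int.cast_add] at h0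
    have h0' : (∫ θ in (-Real.pi)..Real.pi, Complex.exp ((((k : ℤ) - j - 1 : ℤ) : ℂ) * θ * I) *
        ((∑' x, s x * Complex.exp ((x : ℂ) * θ * I)) *
          ∑' y, p (y + (n - k)) * Complex.exp (((y + (n - k) : ℕ) : ℂ) * θ * I))) = 0 := by
      rw [← h0]
      refine intervalIntegral.integral_congr fun θ _ => ?_
      push_cast
      rfl
    rw [h0', norm_zero]
    positivity
  · -- `j + 1 = n`: crude bound
    have hbound : ∀ θ ∈ Set.uIoc (-Real.pi) Real.pi,
        ‖Complex.exp ((((k : ℤ) - j - 1 : ℤ) : ℂ) * θ * I) *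
          ((∑' x, s x * Complex.exp ((x : ℂ) * θ * I)) *
            ∑' y, p (y + (n - k)) * Complex.exp (((y + (n - k) : ℕ) : ℂ) * θ * I))‖ ≤
        C / (1 - σ) * (C * σ ^ (n - k) / (1 - σ)) := by
      intro θ _
      rw [norm_mul, norm_exp_of_re_eq_zero (by simp), one_mul, norm_mul]
      exact mul_le_mul (norm_tsum_mul_le_of_geom hσ0.le hσ1 hs fun x => norm_exp_nat_le x θ)
        (norm_tsum_shift_mul_le hσ0.le hσ1 hp (n - k) fun y => norm_exp_nat_le _ θ)
        (norm_nonneg _) (div_nonneg hC (sub_pos.2 hσ1).le)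
    refine (intervalIntegral.norm_integral_le_of_norm_le_const hbound).trans (le_of_eq ?_)
    have hnj : n - j = 1 := by omega
    rw [hnj, show Real.pi - -Real.pi = 2 * Real.pi by ring,
      abs_of_pos (by positivity : (0 : ℝ) < 2 * Real.pi), pow_add, pow_one]
    field_simp

/-- **The second cross term** `∫ e^{i(k-j-1)θ} G⁻(θ) R⁻_{n-j}(θ) dθ = 0` (all frequencies are
`≤ -(n-j) < k-j-1 - …`, precisely `k-j-1-y-(x+n-j) ≤ k-n-1 < 0`). [folklore] -/
theorem integral_cross_neg_eq_zero (hσ0 : 0 < σ) (hσ1 : σ < 1) (hs : ∀ x, ‖s x‖ ≤ C * σ ^ x)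
    (hp : ∀ y, ‖p y‖ ≤ C * σ ^ y) {n j k : ℕ} (hk : k < n) :
    (∫ θ in (-Real.pi)..Real.pi, Complex.exp ((((k : ℤ) - j - 1 : ℤ) : ℂ) * θ * I) *
        ((∑' y, p y * Complex.exp (-((y : ℂ) * θ * I))) *
          ∑' x, s (x + (n - j)) * Complex.exp (-(((x + (n - j) : ℕ) : ℂ) * θ * I)))) = 0 := by
  have h0 := integral_exp_mul_tsum_mul_tsum_eq_zero
    (summable_norm_mul_of_geom hσ0.le hσ1 hp (u := fun _ => 1) (by simp))
    (summable_norm_shift_mul hσ0.le hσ1 hs (n - j) (u := fun _ => 1) (by simp))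
    (fun y => -(y : ℤ)) (fun x => -((x : ℤ) + (n - j : ℕ))) ((k : ℤ) - j - 1)
    (fun x y => by omega)
  simp only [mul_one, Int.cast_natCast, Int.cast_add, Int.cast_neg, neg_mul] at h0
  rw [← h0]
  refine intervalIntegral.integral_congr fun θ _ => ?_
  push_cast
  rfl

/-- **The double-tail term**: `‖∫ φ e^{-ijθ} e^{ikθ} R⁻_{n-j} R⁺_{n-k}‖ ≤ 2π C² σ^{(n-j)+(n-k)}/(1-σ)²`
for `‖φ‖ ≤ 1`. [folklore] -/
theorem norm_integral_tails_le {φ : ℝ → ℂ} (hφb : ∀ θ, ‖φ θ‖ ≤ 1) (hσ0 : 0 < σ) (hσ1 : σ < 1)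
    (hs : ∀ x, ‖s x‖ ≤ C * σ ^ x) (hp : ∀ y, ‖p y‖ ≤ C * σ ^ y) (n j k : ℕ) :
    ‖∫ θ in (-Real.pi)..Real.pi, φ θ * Complex.exp (-((j : ℂ) * θ * I)) *
        Complex.exp ((k : ℂ) * θ * I) *
        ((∑' x, s (x + (n - j)) * Complex.exp (-(((x + (n - j) : ℕ) : ℂ) * θ * I))) *
          ∑' y, p (y + (n - k)) * Complex.exp (((y + (n - k) : ℕ) : ℂ) * θ * I))‖ ≤
      2 * Real.pi * C ^ 2 / (1 - σ) ^ 2 * σ ^ ((n - j) + (n - k)) := by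
  have hC := nonneg_of_norm_le_geom hs
  have hbound : ∀ θ ∈ Set.uIoc (-Real.pi) Real.pi,
      ‖φ θ * Complex.exp (-((j : ℂ) * θ * I)) * Complex.exp ((k : ℂ) * θ * I) *
        ((∑' x, s (x + (n - j)) * Complex.exp (-(((x + (n - j) : ℕ) : ℂ) * θ * I))) *
          ∑' y, p (y + (n - k)) * Complex.exp (((y + (n - k) : ℕ) : ℂ) * θ * I))‖ ≤
      1 * (C * σ ^ (n - j) / (1 - σ) * (C * σ ^ (n - k) / (1 - σ))) := by
    intro θ _
    rw [norm_mul]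
    refine mul_le_mul ?_ ?_ (norm_nonneg _) zero_le_one
    · rw [norm_mul, norm_mul, norm_exp_of_re_eq_zero (by simp), norm_exp_of_re_eq_zero (by simp),
        mul_one, mul_one]
      exact hφb θ
    · rw [norm_mul]
      exact mul_le_mul (norm_tsum_shift_mul_le hσ0.le hσ1 hs (n - j) fun x => norm_exp_neg_nat_le _ θ)
        (norm_tsum_shift_mul_le hσ0.le hσ1 hp (n - k) fun y => norm_exp_nat_le _ θ)
        (norm_nonneg _) (by positivity)
  refine (intervalIntegral.norm_integral_le_of_norm_le_const hbound).trans (le_of_eq ?_)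
  rw [show Real.pi - -Real.pi = 2 * Real.pi by ring,
    abs_of_pos (by positivity : (0 : ℝ) < 2 * Real.pi), pow_add]
  field_simp

/-- Continuity of the series `θ ↦ ∑ a_{x+N} v_x(θ)` (uniform convergence). [folklore] -/
theorem continuous_tsum_geom {a : ℕ → ℂ} (hσ0 : 0 ≤ σ) (hσ1 : σ < 1)
    (ha : ∀ x, ‖a x‖ ≤ C * σ ^ x) (N : ℕ) {v : ℕ → ℝ → ℂ} (hv : ∀ x, Continuous (v x))
    (hv1 : ∀ x θ, ‖v x θ‖ ≤ 1) : Continuous fun θ => ∑' x, a (x + N) * v x θ := by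
  have hC := nonneg_of_norm_le_geom ha
  refine continuous_tsum (fun x => continuous_const.mul (hv x))
    ((summable_geometric_of_lt_one hσ0 hσ1).mul_left (C * σ ^ N)) fun x θ => ?_
  calc ‖a (x + N) * v x θ‖ = ‖a (x + N)‖ * ‖v x θ‖ := norm_mul _ _
    _ ≤ C * σ ^ (x + N) * 1 := mul_le_mul (ha _) (hv1 x θ) (norm_nonneg _) (by positivity)
    _ = C * σ ^ N * σ ^ x := by rw [pow_add]; ring

/-- The left multiplier against `e^{-ilθ}`: `∑_{l<n} [j ≤ l] s_{l-j} e^{-ilθ} = e^{-ijθ} ∑_{x<n-j} s_x e^{-ixθ}`. [folklore] -/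
theorem sum_left_multiplier (s : ℕ → ℂ) (θ : ℝ) {j n : ℕ} (hj : j ≤ n) :
    ∑ l ∈ range n, (if j ≤ l then s (l - j) else 0) * Complex.exp (-((l : ℂ) * θ * I)) =
      Complex.exp (-((j : ℂ) * θ * I)) *
        ∑ x ∈ range (n - j), s x * Complex.exp (-((x : ℂ) * θ * I)) :=
  sum_ite_le_mul_eq s (u := fun l : ℕ => Complex.exp (-((l : ℂ) * θ * I)))
    (exp_neg_nat_add_mul θ) hj

/-- The right multiplier against `e^{imθ}`: `∑_{m<n} [k ≤ m] p_{m-k} e^{imθ} = e^{ikθ} ∑_{y<n-k} p_y e^{iyθ}`. [folklore] -/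
theorem sum_right_multiplier (p : ℕ → ℂ) (θ : ℝ) {k n : ℕ} (hk : k ≤ n) :
    ∑ m ∈ range n, (if k ≤ m then p (m - k) else 0) * Complex.exp ((m : ℂ) * θ * I) =
      Complex.exp ((k : ℂ) * θ * I) *
        ∑ y ∈ range (n - k), p y * Complex.exp ((y : ℂ) * θ * I) :=
  sum_ite_le_mul_eq p (u := fun m : ℕ => Complex.exp ((m : ℂ) * θ * I)) (exp_nat_add_mul θ) hk

/-- **The entries of `L T_n(φ) U` as integrals**: for a continuous symbol,
`∑_{l,m<n} [j≤l] s_{l-j} φ_{l-m} [k≤m] p_{m-k} = (2π)⁻¹ ∫ φ(θ) (e^{-ijθ} ∑_{x<n-j} s_x e^{-ixθ}) (e^{ikθ} ∑_{y<n-k} p_y e^{iyθ}) dθ`. [folklore] -/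
theorem entry_eq_integral {φ : ℝ → ℂ} (hφc : Continuous φ) (s p : ℕ → ℂ) {n j k : ℕ}
    (hj : j ≤ n) (hk : k ≤ n) :
    (∑ l ∈ range n, ∑ m ∈ range n, (if j ≤ l then s (l - j) else 0) *
        circleCoeff φ ((l : ℤ) - m) * (if k ≤ m then p (m - k) else 0)) =
      (2 * Real.pi : ℂ)⁻¹ * ∫ θ in (-Real.pi)..Real.pi, φ θ *
        (Complex.exp (-((j : ℂ) * θ * I)) *
          ∑ x ∈ range (n - j), s x * Complex.exp (-((x : ℂ) * θ * I))) *
        (Complex.exp ((k : ℂ) * θ * I) *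
          ∑ y ∈ range (n - k), p y * Complex.exp ((y : ℂ) * θ * I)) := by
  -- each term as an integral
  have hterm : ∀ l m : ℕ, (if j ≤ l then s (l - j) else 0) * circleCoeff φ ((l : ℤ) - m) *
      (if k ≤ m then p (m - k) else 0) =
      (2 * Real.pi : ℂ)⁻¹ * ∫ θ in (-Real.pi)..Real.pi, φ θ *
        ((if j ≤ l then s (l - j) else 0) * Complex.exp (-((l : ℂ) * θ * I))) *
        ((if k ≤ m then p (m - k) else 0) * Complex.exp ((m : ℂ) * θ * I)) := by
    intro l m
    have hexp : ∀ θ : ℝ, Complex.exp (-((((l : ℤ) - m : ℤ) : ℂ) * θ * I)) =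
        Complex.exp (-((l : ℂ) * θ * I)) * Complex.exp ((m : ℂ) * θ * I) := fun θ => by
      rw [← Complex.exp_add]; congr 1; push_cast; ring
    have hI : (∫ θ in (-Real.pi)..Real.pi, φ θ *
        ((if j ≤ l then s (l - j) else 0) * Complex.exp (-((l : ℂ) * θ * I))) *
        ((if k ≤ m then p (m - k) else 0) * Complex.exp ((m : ℂ) * θ * I))) =
        ((if j ≤ l then s (l - j) else 0) * (if k ≤ m then p (m - k) else 0)) *
          ∫ θ in (-Real.pi)..Real.pi,
            Complex.exp (-((((l : ℤ) - m : ℤ) : ℂ) * θ * I)) * φ θ := by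
      rw [← intervalIntegral.integral_const_mul (𝕜 := ℂ)]
      refine intervalIntegral.integral_congr fun θ _ => ?_
      rw [hexp]
      ring
    rw [circleCoeff_def, hI]
    ring
  simp_rw [hterm, ← Finset.mul_sum]
  congr 1
  -- integrability of the terms
  have hcont : ∀ l m : ℕ, Continuous (fun θ : ℝ => φ θ *
      ((if j ≤ l then s (l - j) else 0) * Complex.exp (-((l : ℂ) * θ * I))) *
      ((if k ≤ m then p (m - k) else 0) * Complex.exp ((m : ℂ) * θ * I))) := fun l m => by
    fun_prop
  symm
  calc (∫ θ in (-Real.pi)..Real.pi, φ θ *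
        (Complex.exp (-((j : ℂ) * θ * I)) *
          ∑ x ∈ range (n - j), s x * Complex.exp (-((x : ℂ) * θ * I))) *
        (Complex.exp ((k : ℂ) * θ * I) *
          ∑ y ∈ range (n - k), p y * Complex.exp ((y : ℂ) * θ * I)))
      = ∫ θ in (-Real.pi)..Real.pi, ∑ l ∈ range n, ∑ m ∈ range n, φ θ *
          ((if j ≤ l then s (l - j) else 0) * Complex.exp (-((l : ℂ) * θ * I))) *
          ((if k ≤ m then p (m - k) else 0) * Complex.exp ((m : ℂ) * θ * I)) := by
        refine intervalIntegral.integral_congr fun θ _ => ?_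
        rw [← sum_left_multiplier s θ hj, ← sum_right_multiplier p θ hk, mul_assoc,
          Finset.sum_mul_sum, Finset.mul_sum]
        refine Finset.sum_congr rfl fun l _ => ?_
        rw [Finset.mul_sum]
        refine Finset.sum_congr rfl fun m _ => ?_
        ring
    _ = ∑ l ∈ range n, ∫ θ in (-Real.pi)..Real.pi, ∑ m ∈ range n, φ θ *
          ((if j ≤ l then s (l - j) else 0) * Complex.exp (-((l : ℂ) * θ * I))) *
          ((if k ≤ m then p (m - k) else 0) * Complex.exp ((m : ℂ) * θ * I)) :=
        intervalIntegral.integral_finsetSum fun l _ =>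
          (continuous_finsetSum (range n) fun m _ => hcont l m).intervalIntegrable _ _
    _ = ∑ l ∈ range n, ∑ m ∈ range n, ∫ θ in (-Real.pi)..Real.pi, φ θ *
          ((if j ≤ l then s (l - j) else 0) * Complex.exp (-((l : ℂ) * θ * I))) *
          ((if k ≤ m then p (m - k) else 0) * Complex.exp ((m : ℂ) * θ * I)) :=
        Finset.sum_congr rfl fun l _ => intervalIntegral.integral_finsetSum fun m _ =>
          (hcont l m).intervalIntegrable _ _

/-- **The entries of `L T_n(φ) U + S`** are `O(σ^{(n-j)+(n-k)})`: with the triangular multipliers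
built from `s` and `p`, `(L T_n(φ) U)_{jk} = -[k = j+1] + K_{jk}`,
`|K_{jk}| ≤ C²(1-σ)^{-2}(σ^{-1} + 1) σ^{(n-j)+(n-k)}`. [folklore] -/
theorem norm_entry_add_shift_le {φ : ℝ → ℂ} (hφc : Continuous φ) (hφb : ∀ θ, ‖φ θ‖ ≤ 1)
    (hσ0 : 0 < σ) (hσ1 : σ < 1) (hs : ∀ x, ‖s x‖ ≤ C * σ ^ x) (hp : ∀ y, ‖p y‖ ≤ C * σ ^ y)
    (hinv : ∀ θ : ℝ, (∑' x, s x * Complex.exp ((x : ℂ) * θ * I)) *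
      (∑' y, p y * Complex.exp ((y : ℂ) * θ * I)) = 1)
    (hfac : ∀ θ : ℝ, φ θ = -Complex.exp (-(θ * I)) *
      (∑' x, s x * Complex.exp ((x : ℂ) * θ * I)) *
        ∑' y, p y * Complex.exp (-((y : ℂ) * θ * I)))
    {n j k : ℕ} (hj : j < n) (hk : k < n) :
    ‖(∑ l ∈ range n, ∑ m ∈ range n, (if j ≤ l then s (l - j) else 0) *
        circleCoeff φ ((l : ℤ) - m) * (if k ≤ m then p (m - k) else 0)) +
        (if k = j + 1 then 1 else 0)‖ ≤
      C ^ 2 / (1 - σ) ^ 2 * (σ⁻¹ + 1) * σ ^ ((n - j) + (n - k)) := by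
  have hC := nonneg_of_norm_le_geom hs
  -- the six series
  obtain ⟨Sp, hSp⟩ : ∃ Sp : ℝ → ℂ, Sp = fun θ : ℝ => ∑' x, s x * Complex.exp ((x : ℂ) * θ * I) :=
    ⟨_, rfl⟩
  obtain ⟨Sm, hSm⟩ : ∃ Sm : ℝ → ℂ, Sm = fun θ : ℝ => ∑' x, s x * Complex.exp (-((x : ℂ) * θ * I)) :=
    ⟨_, rfl⟩
  obtain ⟨Gp, hGp⟩ : ∃ Gp : ℝ → ℂ, Gp = fun θ : ℝ => ∑' y, p y * Complex.exp ((y : ℂ) * θ * I) :=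
    ⟨_, rfl⟩
  obtain ⟨Gm, hGm⟩ : ∃ Gm : ℝ → ℂ, Gm = fun θ : ℝ => ∑' y, p y * Complex.exp (-((y : ℂ) * θ * I)) :=
    ⟨_, rfl⟩
  obtain ⟨Rm, hRm⟩ : ∃ Rm : ℝ → ℂ, Rm = fun θ : ℝ =>
      ∑' x, s (x + (n - j)) * Complex.exp (-(((x + (n - j) : ℕ) : ℂ) * θ * I)) := ⟨_, rfl⟩
  obtain ⟨Rp, hRp⟩ : ∃ Rp : ℝ → ℂ, Rp = fun θ : ℝ =>
      ∑' y, p (y + (n - k)) * Complex.exp (((y + (n - k) : ℕ) : ℂ) * θ * I) := ⟨_, rfl⟩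
  -- the relations between them
  have hinv' : ∀ θ, Sp θ * Gp θ = 1 := fun θ => by rw [hSp, hGp]; exact hinv θ
  have hinv'' : ∀ θ, Sm θ * Gm θ = 1 := fun θ => by
    have h := hinv (-θ)
    simp only [Complex.ofReal_neg, mul_neg, neg_mul] at h
    rw [hSm, hGm]
    exact h
  have hfac' : ∀ θ, φ θ = -Complex.exp (-(θ * I)) * Sp θ * Gm θ := fun θ => by
    rw [hSp, hGm]; exact hfac θ
  have hPSm : ∀ θ : ℝ, ∑ x ∈ range (n - j), s x * Complex.exp (-((x : ℂ) * θ * I)) =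
      Sm θ - Rm θ := fun θ => by
    rw [hSm, hRm]
    exact eq_sub_of_add_eq (Summable.sum_add_tsum_nat_add (n - j)
      (summable_norm_mul_of_geom hσ0.le hσ1 hs fun x => norm_exp_neg_nat_le x θ).of_norm)
  have hPSp : ∀ θ : ℝ, ∑ y ∈ range (n - k), p y * Complex.exp ((y : ℂ) * θ * I) =
      Gp θ - Rp θ := fun θ => by
    rw [hGp, hRp]
    exact eq_sub_of_add_eq (Summable.sum_add_tsum_nat_add (n - k)
      (summable_norm_mul_of_geom hσ0.le hσ1 hp fun y => norm_exp_nat_le y θ).of_norm)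
  -- continuity
  have hcSp : Continuous Sp := by
    rw [hSp]
    simpa using continuous_tsum_geom hσ0.le hσ1 hs 0
      (v := fun x θ => Complex.exp ((x : ℂ) * θ * I)) (fun x => by fun_prop)
      fun x θ => norm_exp_nat_le x θ
  have hcGm : Continuous Gm := by
    rw [hGm]
    simpa using continuous_tsum_geom hσ0.le hσ1 hp 0
      (v := fun y θ => Complex.exp (-((y : ℂ) * θ * I))) (fun y => by fun_prop)
      fun y θ => norm_exp_neg_nat_le y θ
  have hcRm : Continuous Rm := by
    rw [hRm]
    exact continuous_tsum_geom hσ0.le hσ1 hs (n - j)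
      (v := fun x θ => Complex.exp (-(((x + (n - j) : ℕ) : ℂ) * θ * I))) (fun x => by fun_prop)
      fun x θ => norm_exp_neg_nat_le _ θ
  have hcRp : Continuous Rp := by
    rw [hRp]
    exact continuous_tsum_geom hσ0.le hσ1 hp (n - k)
      (v := fun y θ => Complex.exp (((y + (n - k) : ℕ) : ℂ) * θ * I)) (fun y => by fun_prop)
      fun y θ => norm_exp_nat_le _ θ
  -- Step 1: the entry as an integral, and the integrand identity
  rw [entry_eq_integral hφc s p hj.le hk.le]
  have hI : (∫ θ in (-Real.pi)..Real.pi, φ θ *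
      (Complex.exp (-((j : ℂ) * θ * I)) *
        ∑ x ∈ range (n - j), s x * Complex.exp (-((x : ℂ) * θ * I))) *
      (Complex.exp ((k : ℂ) * θ * I) *
        ∑ y ∈ range (n - k), p y * Complex.exp ((y : ℂ) * θ * I))) =
      ∫ θ in (-Real.pi)..Real.pi,
        (-(Complex.exp (-(θ * I)) * Complex.exp (-((j : ℂ) * θ * I)) *
            Complex.exp ((k : ℂ) * θ * I)) +
          Complex.exp (-(θ * I)) * Complex.exp (-((j : ℂ) * θ * I)) *
            Complex.exp ((k : ℂ) * θ * I) * (Sp θ * Rp θ) +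
          Complex.exp (-(θ * I)) * Complex.exp (-((j : ℂ) * θ * I)) *
            Complex.exp ((k : ℂ) * θ * I) * (Gm θ * Rm θ) +
          φ θ * Complex.exp (-((j : ℂ) * θ * I)) * Complex.exp ((k : ℂ) * θ * I) *
            (Rm θ * Rp θ)) := by
    refine intervalIntegral.integral_congr fun θ _ => ?_
    rw [hPSm θ, hPSp θ]
    exact integrand_identity (hinv' θ) (hinv'' θ) (hfac' θ)
  have hii : ∀ {f : ℝ → ℂ}, Continuous f → IntervalIntegrable f volume (-Real.pi) Real.pi :=
    fun hf => hf.intervalIntegrable _ _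
  rw [hI, intervalIntegral.integral_add (hii (by fun_prop)) (hii (by fun_prop)),
    intervalIntegral.integral_add (hii (by fun_prop)) (hii (by fun_prop)),
    intervalIntegral.integral_add (hii (by fun_prop)) (hii (by fun_prop))]
  -- Step 2: the four integrals
  have hT1 := integral_shift_term j k
  have hT2 : ‖∫ θ in (-Real.pi)..Real.pi, Complex.exp (-(θ * I)) *
      Complex.exp (-((j : ℂ) * θ * I)) * Complex.exp ((k : ℂ) * θ * I) * (Sp θ * Rp θ)‖ ≤
      2 * Real.pi * C ^ 2 / ((1 - σ) ^ 2 * σ) * σ ^ ((n - j) + (n - k)) := by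
    simp_rw [exp_shift_eq]
    rw [hSp, hRp]
    exact norm_integral_cross_pos_le hσ0 hσ1 hs hp hj hk
  have hT3 : (∫ θ in (-Real.pi)..Real.pi, Complex.exp (-(θ * I)) *
      Complex.exp (-((j : ℂ) * θ * I)) * Complex.exp ((k : ℂ) * θ * I) * (Gm θ * Rm θ)) = 0 := by
    simp_rw [exp_shift_eq]
    rw [hGm, hRm]
    exact integral_cross_neg_eq_zero hσ0 hσ1 hs hp hk
  have hT4 : ‖∫ θ in (-Real.pi)..Real.pi, φ θ * Complex.exp (-((j : ℂ) * θ * I)) *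
      Complex.exp ((k : ℂ) * θ * I) * (Rm θ * Rp θ)‖ ≤
      2 * Real.pi * C ^ 2 / (1 - σ) ^ 2 * σ ^ ((n - j) + (n - k)) := by
    rw [hRm, hRp]
    exact norm_integral_tails_le hφb hσ0 hσ1 hs hp n j k
  -- Step 3: assemble
  have h2π : (2 * Real.pi : ℂ) ≠ 0 := by exact_mod_cast (mul_pos two_pos Real.pi_pos).ne'
  have hnorm2π : ‖(2 * Real.pi : ℂ)⁻¹‖ = (2 * Real.pi)⁻¹ := by
    rw [norm_inv, show (2 * Real.pi : ℂ) = ((2 * Real.pi : ℝ) : ℂ) by push_cast; ring,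
      Complex.norm_real, Real.norm_of_nonneg (by positivity)]
  rw [hT1, hT3, add_zero]
  set I2 := ∫ θ in (-Real.pi)..Real.pi, Complex.exp (-(θ * I)) *
      Complex.exp (-((j : ℂ) * θ * I)) * Complex.exp ((k : ℂ) * θ * I) * (Sp θ * Rp θ)
  set I4 := ∫ θ in (-Real.pi)..Real.pi, φ θ * Complex.exp (-((j : ℂ) * θ * I)) *
      Complex.exp ((k : ℂ) * θ * I) * (Rm θ * Rp θ)
  have hkey : (2 * Real.pi : ℂ)⁻¹ * (-(if k = j + 1 then 2 * (Real.pi : ℂ) else 0) + I2 + I4) +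
      (if k = j + 1 then 1 else 0) = (2 * Real.pi : ℂ)⁻¹ * (I2 + I4) := by
    split_ifs
    · field_simp
      ring
    · ring
  rw [hkey, norm_mul, hnorm2π]
  calc (2 * Real.pi)⁻¹ * ‖I2 + I4‖ ≤ (2 * Real.pi)⁻¹ * (‖I2‖ + ‖I4‖) := by
        gcongr; exact norm_add_le _ _
    _ ≤ (2 * Real.pi)⁻¹ * (2 * Real.pi * C ^ 2 / ((1 - σ) ^ 2 * σ) * σ ^ ((n - j) + (n - k)) +
          2 * Real.pi * C ^ 2 / (1 - σ) ^ 2 * σ ^ ((n - j) + (n - k))) := by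
        gcongr
    _ = C ^ 2 / (1 - σ) ^ 2 * (σ⁻¹ + 1) * σ ^ ((n - j) + (n - k)) := by
        have hσ1' : (1 - σ) ≠ 0 := (sub_pos.2 hσ1).ne'
        field_simp

/-- `∑_{k<m} σ^{m-k} ≤ σ/(1-σ)` for `0 ≤ σ < 1`. [folklore] -/
theorem sum_range_pow_sub_le (hσ0 : 0 ≤ σ) (hσ1 : σ < 1) (m : ℕ) :
    ∑ k ∈ range m, σ ^ (m - k) ≤ σ / (1 - σ) := by
  have hgeom := summable_geometric_of_lt_one hσ0 hσ1
  calc ∑ k ∈ range m, σ ^ (m - k) = ∑ k ∈ range m, σ ^ (m - 1 - k + 1) :=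
        Finset.sum_congr rfl fun k hk => by
          rw [show m - k = m - 1 - k + 1 by have := Finset.mem_range.1 hk; omega]
    _ = ∑ i ∈ range m, σ ^ (i + 1) := Finset.sum_range_reflect (fun i => σ ^ (i + 1)) m
    _ = σ * ∑ i ∈ range m, σ ^ i := by
        rw [Finset.mul_sum]
        exact Finset.sum_congr rfl fun i _ => by ring
    _ ≤ σ * ∑' i, σ ^ i := by
        gcongr
        exact hgeom.sum_le_tsum (range m) fun i _ => pow_nonneg hσ0 i
    _ = σ / (1 - σ) := by rw [tsum_geometric_of_lt_one hσ0 hσ1, div_eq_mul_inv]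

/-- At most one row `j` has `k = j + 1`, and none if `k = 0`. [folklore] -/
theorem sum_range_ite_eq_succ_le (n k : ℕ) :
    ∑ j ∈ range n, (if k = j + 1 then (1 : ℝ) else 0) ≤ if 1 ≤ k then 1 else 0 := by
  rcases k with _ | k
  · simp
  · simp only [add_left_inj, Finset.sum_ite_eq, Finset.mem_range, le_add_iff_nonneg_left,
      zero_le, if_true]
    split_ifs <;> norm_num

/-- `∏_{k<m} (1 + K x_k) ≤ exp(K ∑ x_k)`-type bound: `∏_{k<m} (1 + K σ^{m-k}) ≤ exp (K σ/(1-σ))`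
for `K ≥ 0`. [folklore] -/
theorem prod_one_add_mul_pow_le (hσ0 : 0 ≤ σ) (hσ1 : σ < 1) {K : ℝ} (hK : 0 ≤ K) (m : ℕ) :
    ∏ k ∈ range m, (1 + K * σ ^ (m - k)) ≤ Real.exp (K * (σ / (1 - σ))) := by
  calc ∏ k ∈ range m, (1 + K * σ ^ (m - k)) ≤ ∏ k ∈ range m, Real.exp (K * σ ^ (m - k)) :=
        Finset.prod_le_prod (fun k _ => by positivity) fun k _ => by
          rw [add_comm]; exact Real.add_one_le_exp _
    _ = Real.exp (K * ∑ k ∈ range m, σ ^ (m - k)) := by rw [Finset.mul_sum, Real.exp_sum]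
    _ ≤ Real.exp (K * (σ / (1 - σ))) :=
        Real.exp_le_exp.2 (mul_le_mul_of_nonneg_left (sum_range_pow_sub_le hσ0 hσ1 m) hK)

/-- **The abstract decay theorem.** Let `φ` be a continuous symbol with `|φ| ≤ 1`, and let
`s`, `p` be geometrically bounded sequences (`|sₓ|, |pₓ| ≤ C σˣ`, `0 < σ < 1`, `s₀ = p₀ = 1`) with
`(∑ sₓ e^{ixθ})(∑ p_y e^{iyθ}) = 1` and `φ(θ) = -e^{-iθ} (∑ sₓ e^{ixθ})(∑ p_y e^{-iyθ})`. Then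
`|D_n(φ)| ≤ max(1, K₁ e^{K₁σ/(1-σ)}) σⁿ` with `K₁ = C²(1-σ)^{-2}(σ^{-1}+1) σ/(1-σ)`: the
triangular multipliers turn `T_n(φ)` into `-S + K` and the column-sum bound applies. [folklore] -/
theorem norm_toeplitzDet_le_of_factorization {φ : ℝ → ℂ} (hφc : Continuous φ)
    (hφb : ∀ θ, ‖φ θ‖ ≤ 1) (hσ0 : 0 < σ) (hσ1 : σ < 1) (hs : ∀ x, ‖s x‖ ≤ C * σ ^ x)
    (hp : ∀ y, ‖p y‖ ≤ C * σ ^ y) (hs0 : s 0 = 1) (hp0 : p 0 = 1)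
    (hinv : ∀ θ : ℝ, (∑' x, s x * Complex.exp ((x : ℂ) * θ * I)) *
      (∑' y, p y * Complex.exp ((y : ℂ) * θ * I)) = 1)
    (hfac : ∀ θ : ℝ, φ θ = -Complex.exp (-(θ * I)) *
      (∑' x, s x * Complex.exp ((x : ℂ) * θ * I)) *
        ∑' y, p y * Complex.exp (-((y : ℂ) * θ * I))) (n : ℕ) :
    ‖toeplitzDet (circleCoeff φ) n‖ ≤
      max 1 (C ^ 2 / (1 - σ) ^ 2 * (σ⁻¹ + 1) * (σ / (1 - σ)) *
        Real.exp (C ^ 2 / (1 - σ) ^ 2 * (σ⁻¹ + 1) * (σ / (1 - σ)) * (σ / (1 - σ)))) * σ ^ n := by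
  have hC := nonneg_of_norm_le_geom hs
  set K₀ : ℝ := C ^ 2 / (1 - σ) ^ 2 * (σ⁻¹ + 1) with hK₀
  set K₁ : ℝ := K₀ * (σ / (1 - σ)) with hK₁
  have h1σ : 0 < 1 - σ := sub_pos.2 hσ1
  have hK₀0 : 0 ≤ K₀ := by positivity
  have hK₁0 : 0 ≤ K₁ := by positivity
  rcases n with _ | m
  · simp
  set n := m + 1 with hn
  set c := circleCoeff φ
  -- the triangular multipliers
  set L : Matrix (Fin n) (Fin n) ℂ :=
    Matrix.of fun j l : Fin n => if (j : ℕ) ≤ l then s (l - j) else 0 with hL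
  set U : Matrix (Fin n) (Fin n) ℂ :=
    Matrix.of fun m' k : Fin n => if (k : ℕ) ≤ m' then p (m' - k) else 0 with hU
  have hLdet : L.det = 1 := by
    rw [Matrix.det_of_upperTriangular]
    · exact Finset.prod_eq_one fun i _ => by simp [hL, hs0]
    · intro i j hij
      exact if_neg (not_le.2 (Fin.lt_def.1 hij))
  have hUdet : U.det = 1 := by
    rw [Matrix.det_of_lowerTriangular]
    · exact Finset.prod_eq_one fun i _ => by simp [hU, hp0]
    · intro i j hij
      exact if_neg (not_le.2 (Fin.lt_def.1 (OrderDual.toDual_lt_toDual.1 hij)))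
  have hdet : toeplitzDet c n = (L * toeplitzMatrix c n * U).det := by
    rw [Matrix.det_mul, Matrix.det_mul, hLdet, hUdet, one_mul, mul_one, toeplitzDet]
  -- the entries of `L T U`
  have hentry : ∀ j k : Fin n, (L * toeplitzMatrix c n * U) j k =
      ∑ l ∈ range n, ∑ m ∈ range n, (if (j : ℕ) ≤ l then s (l - j) else 0) *
        c ((l : ℤ) - m) * (if (k : ℕ) ≤ m then p (m - k) else 0) := by
    intro j k
    simp only [Matrix.mul_apply, hL, hU, Matrix.of_apply, toeplitzMatrix_apply, Finset.sum_mul]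
    rw [Finset.sum_comm, ← Fin.sum_univ_eq_sum_range]
    refine Finset.sum_congr rfl fun l _ => ?_
    rw [← Fin.sum_univ_eq_sum_range]
  -- column sums
  have hcol : ∀ k : Fin n, ∑ j : Fin n, ‖(L * toeplitzMatrix c n * U) j k‖ ≤
      (if 1 ≤ (k : ℕ) then 1 else 0) + K₁ * σ ^ (n - k) := by
    intro k
    have hjk : ∀ j : Fin n, ‖(L * toeplitzMatrix c n * U) j k‖ ≤
        (if (k : ℕ) = j + 1 then 1 else 0) + K₀ * σ ^ ((n - j) + (n - k)) := by
      intro j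
      rw [hentry]
      have h := norm_entry_add_shift_le hφc hφb hσ0 hσ1 hs hp hinv hfac j.isLt k.isLt
      have hδ : ‖(if (k : ℕ) = j + 1 then (1 : ℂ) else 0)‖ =
          if (k : ℕ) = j + 1 then (1 : ℝ) else 0 := by
        split_ifs <;> simp
      calc _ = ‖(∑ l ∈ range n, ∑ m ∈ range n, (if (j : ℕ) ≤ l then s (l - j) else 0) *
              c ((l : ℤ) - m) * (if (k : ℕ) ≤ m then p (m - k) else 0)) +
              (if (k : ℕ) = j + 1 then (1 : ℂ) else 0) -
              (if (k : ℕ) = j + 1 then (1 : ℂ) else 0)‖ := by rw [add_sub_cancel_right]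
        _ ≤ _ := norm_sub_le _ _
        _ ≤ K₀ * σ ^ ((n - j) + (n - k)) + (if (k : ℕ) = j + 1 then (1 : ℝ) else 0) := by
            rw [hδ]; exact add_le_add h le_rfl
        _ = _ := add_comm _ _
    calc ∑ j : Fin n, ‖(L * toeplitzMatrix c n * U) j k‖
        ≤ ∑ j : Fin n, ((if (k : ℕ) = j + 1 then (1 : ℝ) else 0) +
            K₀ * σ ^ ((n - j) + (n - k))) := Finset.sum_le_sum fun j _ => hjk j
      _ = (∑ j ∈ range n, if (k : ℕ) = j + 1 then (1 : ℝ) else 0) +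
            K₀ * σ ^ (n - k) * ∑ j ∈ range n, σ ^ (n - j) := by
          rw [Finset.sum_add_distrib, Fin.sum_univ_eq_sum_range (fun j => if (k : ℕ) = j + 1
            then (1 : ℝ) else 0) n, Fin.sum_univ_eq_sum_range (fun j => K₀ *
            σ ^ ((n - j) + (n - k))) n, Finset.mul_sum]
          congr 1
          exact Finset.sum_congr rfl fun j _ => by rw [pow_add]; ring
      _ ≤ (if 1 ≤ (k : ℕ) then 1 else 0) + K₀ * σ ^ (n - k) * (σ / (1 - σ)) := by
          gcongr
          · exact sum_range_ite_eq_succ_le n k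
          · exact sum_range_pow_sub_le hσ0.le hσ1 n
      _ = (if 1 ≤ (k : ℕ) then 1 else 0) + K₁ * σ ^ (n - k) := by rw [hK₁]; ring
  -- the determinant
  calc ‖toeplitzDet c n‖ = ‖(L * toeplitzMatrix c n * U).det‖ := by rw [hdet]
    _ ≤ ∏ k : Fin n, ∑ j : Fin n, ‖(L * toeplitzMatrix c n * U) j k‖ :=
        norm_det_le_prod_colSum _
    _ ≤ ∏ k : Fin n, ((if 1 ≤ (k : ℕ) then 1 else 0) + K₁ * σ ^ (n - k)) :=
        Finset.prod_le_prod (fun k _ => Finset.sum_nonneg fun j _ => norm_nonneg _)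
          fun k _ => hcol k
    _ = ∏ k ∈ range n, ((if 1 ≤ k then 1 else 0) + K₁ * σ ^ (n - k)) :=
        Fin.prod_univ_eq_prod_range (fun k => (if 1 ≤ k then 1 else 0) + K₁ * σ ^ (n - k)) n
    _ = (∏ k ∈ range m, (1 + K₁ * σ ^ (m - k))) * (K₁ * σ ^ n) := by
        rw [hn, Finset.prod_range_succ']
        congr 1
        · exact Finset.prod_congr rfl fun k _ => by
            simp only [le_add_iff_nonneg_left, zero_le, if_true, Nat.succ_sub_succ]
        · simp
    _ ≤ Real.exp (K₁ * (σ / (1 - σ))) * (K₁ * σ ^ n) :=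
        mul_le_mul_of_nonneg_right (prod_one_add_mul_pow_le hσ0.le hσ1 hK₁0 m) (by positivity)
    _ = K₁ * Real.exp (K₁ * (σ / (1 - σ))) * σ ^ n := by ring
    _ ≤ max 1 (K₁ * Real.exp (K₁ * (σ / (1 - σ)))) * σ ^ n := by
        gcongr
        exact le_max_right _ _

/-- **Exponential decay, abstract form**: under the hypotheses of
`norm_toeplitzDet_le_of_factorization`, `|D_n(φ)| ≤ C' e^{-cn}` for some `C'` and `c > 0`
(`c = -log σ`). [folklore] -/
theorem toeplitzDet_exp_decay_of_factorization {φ : ℝ → ℂ} (hφc : Continuous φ)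
    (hφb : ∀ θ, ‖φ θ‖ ≤ 1) (hσ0 : 0 < σ) (hσ1 : σ < 1) (hs : ∀ x, ‖s x‖ ≤ C * σ ^ x)
    (hp : ∀ y, ‖p y‖ ≤ C * σ ^ y) (hs0 : s 0 = 1) (hp0 : p 0 = 1)
    (hinv : ∀ θ : ℝ, (∑' x, s x * Complex.exp ((x : ℂ) * θ * I)) *
      (∑' y, p y * Complex.exp ((y : ℂ) * θ * I)) = 1)
    (hfac : ∀ θ : ℝ, φ θ = -Complex.exp (-(θ * I)) *
      (∑' x, s x * Complex.exp ((x : ℂ) * θ * I)) *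
        ∑' y, p y * Complex.exp (-((y : ℂ) * θ * I))) :
    ∃ C' c : ℝ, 0 < c ∧ ∀ n : ℕ, ‖toeplitzDet (circleCoeff φ) n‖ ≤ C' * Real.exp (-c * n) := by
  obtain ⟨K, hK⟩ : ∃ K : ℝ, ∀ n, ‖toeplitzDet (circleCoeff φ) n‖ ≤ K * σ ^ n :=
    ⟨_, norm_toeplitzDet_le_of_factorization hφc hφb hσ0 hσ1 hs hp hs0 hp0 hinv hfac⟩
  refine ⟨K, -Real.log σ, neg_pos.2 (Real.log_neg hσ0 hσ1), fun n => ?_⟩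
  rw [neg_neg, show Real.log σ * (n : ℝ) = n * Real.log σ from mul_comm _ _, Real.exp_nat_mul,
    Real.exp_log hσ0]
  exact hK n

end Abstract

/-! ### Onsager's symbol above `T_c`: the factorization `φ_β = -e^{-iθ} h(e^{iθ}) g(e^{-iθ})` -/

section Model

/-- `w^{1/2} (w̄)^{-1/2} = w/|w|` in the open right half plane (principal branches). [folklore] -/
theorem cpow_half_mul_conj_cpow_neg_half {w : ℂ} (hw : 0 < w.re) :
    w ^ (1 / 2 : ℂ) * (starRingEnd ℂ) w ^ (-(1 / 2) : ℂ) = w / (‖w‖ : ℂ) := by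
  have hw0 : w ≠ 0 := fun h => by simp [h] at hw
  have harg : w.arg ≠ Real.pi := fun h => by
    rw [Complex.arg_eq_pi_iff] at h
    linarith [h.1]
  set t := w ^ (1 / 2 : ℂ) with ht
  have ht0 : t ≠ 0 := by
    rw [ht, Ne, Complex.cpow_eq_zero_iff]
    simp [hw0]
  have htt : t * t = w := by
    rw [ht, ← Complex.cpow_add _ _ hw0]
    norm_num
  have hhalf : (starRingEnd ℂ) (1 / 2 : ℂ) = 1 / 2 := by rw [map_div₀, map_one, map_ofNat]
  have hconj : (starRingEnd ℂ) w ^ (-(1 / 2) : ℂ) = ((starRingEnd ℂ) t)⁻¹ := by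
    rw [Complex.cpow_neg, Complex.conj_cpow _ _ harg, hhalf]
  have hct0 : (starRingEnd ℂ) t ≠ 0 := (map_ne_zero _).2 ht0
  have hnorm : ((‖w‖ : ℝ) : ℂ) = (starRingEnd ℂ) t * t := by
    rw [Complex.conj_mul', ← htt, norm_mul]
    push_cast
    ring
  rw [hconj, hnorm, ← htt]
  field_simp

/-- The factor identity `(1 - γe^{iθ})/|1 - γe^{iθ}| = (1 - γe^{iθ})^{1/2} (1 - γe^{-iθ})^{-1/2}`
for `0 ≤ γ < 1`. [folklore] -/
theorem one_sub_mul_exp_div_norm {γ : ℝ} (hγ0 : 0 ≤ γ) (hγ1 : γ < 1) (θ : ℝ) :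
    (1 - (γ : ℂ) * Complex.exp (θ * I)) / (‖1 - (γ : ℂ) * Complex.exp (θ * I)‖ : ℂ) =
      (1 - (γ : ℂ) * Complex.exp (θ * I)) ^ (1 / 2 : ℂ) *
        (1 - (γ : ℂ) * Complex.exp (-(θ * I))) ^ (-(1 / 2) : ℂ) := by
  have hre : 0 < (1 - (γ : ℂ) * Complex.exp (θ * I)).re := by
    have h1 : ((γ : ℂ) * Complex.exp (θ * I)).re ≤ γ := by
      refine (Complex.re_le_norm _).trans ?_
      rw [norm_real_mul_exp_mul_I hγ0]
    simp only [Complex.sub_re, Complex.one_re]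
    linarith
  rw [← cpow_half_mul_conj_cpow_neg_half hre, conj_one_sub_real_mul_exp]

/-- **The winding-number `-1` factorization of Onsager's symbol above `T_c`.** For
`0 < β < β_c(2)` (`γ₁ < 1 < γ₂`) and all `θ`:
`φ_β(θ) = -e^{-iθ} · h(e^{iθ}) · g(e^{-iθ})` with `h(z) = (1-γ₁z)^{1/2}(1-z/γ₂)^{1/2}` and
`g(z) = (1-γ₁z)^{-1/2}(1-z/γ₂)^{-1/2}` (principal branches; `1 - γ₂e^{-iθ} = -γ₂e^{-iθ}(1 - e^{iθ}/γ₂)`),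
the form `φ(z) = z^{-1} b(z)`, `b` of zero winding, of Deift–Its–Krasovsky §5. [cite: DeiftItsKrasovsky2013, §5, eq. (64) with §2 eqs. (24), (26)] -/
theorem onsagerSymbol_eq_factorization {β : ℝ} (hβ0 : 0 < β) (hβc : β < criticalBetaTwo)
    (θ : ℝ) :
    onsagerSymbol β θ = -Complex.exp (-(θ * I)) *
      ((1 - (onsagerGammaOne β : ℂ) * Complex.exp (θ * I)) ^ (1 / 2 : ℂ) *
        (1 - (onsagerGammaTwo β : ℂ)⁻¹ * Complex.exp (θ * I)) ^ (1 / 2 : ℂ)) *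
      ((1 - (onsagerGammaOne β : ℂ) * Complex.exp (-(θ * I))) ^ (-(1 / 2) : ℂ) *
        (1 - (onsagerGammaTwo β : ℂ)⁻¹ * Complex.exp (-(θ * I))) ^ (-(1 / 2) : ℂ)) := by
  have hγ₁0 := onsagerGammaOne_pos hβ0
  have hγ₁1 := onsagerGammaOne_lt_one hβ0
  have hγ₂1 : 1 < onsagerGammaTwo β := (one_lt_onsagerGammaTwo_iff hβ0).2 hβc
  have hγ₂0 : 0 < onsagerGammaTwo β := one_pos.trans hγ₂1
  have hi0 : 0 ≤ (onsagerGammaTwo β)⁻¹ := inv_nonneg.2 hγ₂0.le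
  have hi1 : (onsagerGammaTwo β)⁻¹ < 1 := inv_lt_one_of_one_lt₀ hγ₂1
  -- the two factor identities
  have hu := one_sub_mul_exp_div_norm hγ₁0.le hγ₁1 θ
  have hv := one_sub_mul_exp_div_norm hi0 hi1 θ
  push_cast at hv
  -- `1 - γ₂ e^{-iθ} = -γ₂ e^{-iθ} (1 - γ₂⁻¹ e^{iθ})`
  have hγ₂ne : (onsagerGammaTwo β : ℂ) ≠ 0 := by exact_mod_cast hγ₂0.ne'
  have hsecond : 1 - (onsagerGammaTwo β : ℂ) * Complex.exp (-(θ * I)) =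
      -(onsagerGammaTwo β : ℂ) * Complex.exp (-(θ * I)) *
        (1 - (onsagerGammaTwo β : ℂ)⁻¹ * Complex.exp (θ * I)) := by
    rw [Complex.exp_neg]
    field_simp
    ring
  have hnorm2 : (‖1 - (onsagerGammaTwo β : ℂ) * Complex.exp (-(θ * I))‖ : ℂ) =
      (onsagerGammaTwo β : ℂ) * ‖1 - (onsagerGammaTwo β : ℂ)⁻¹ * Complex.exp (θ * I)‖ := by
    rw [hsecond, norm_mul, norm_mul, norm_neg, Complex.norm_real, Real.norm_of_nonneg hγ₂0.le,
      show -((θ : ℂ) * I) = ((-θ : ℝ) : ℂ) * I by push_cast; ring, Complex.norm_exp_ofReal_mul_I]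
    push_cast
    ring
  have hn1 : (‖1 - (onsagerGammaOne β : ℂ) * Complex.exp (θ * I)‖ : ℂ) ≠ 0 := by
    exact_mod_cast norm_ne_zero_iff.2 (one_sub_gammaOne_ne_zero hβ0 θ)
  have hn2 : (‖1 - (onsagerGammaTwo β : ℂ)⁻¹ * Complex.exp (θ * I)‖ : ℂ) ≠ 0 := by
    have h : (1 - (onsagerGammaTwo β : ℂ)⁻¹ * Complex.exp (θ * I)) ≠ 0 := by
      have := one_sub_gammaOne_ne_zero hβ0 θ
      intro h0
      apply one_sub_gammaTwo_ne_zero hβ0 hβc.ne θ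
      rw [hsecond, h0, mul_zero]
    exact_mod_cast norm_ne_zero_iff.2 h
  have hE : Complex.exp (-(θ * I)) ≠ 0 := Complex.exp_ne_zero _
  rw [onsagerSymbol, onsagerW, norm_mul, Complex.ofReal_mul, hnorm2, hsecond]
  conv_rhs => rw [mul_assoc, mul_mul_mul_comm]
  rw [← hu, ← hv]
  field_simp

/-- Onsager's symbol is continuous off the critical point (local copy of
`OnsagerToeplitzProofs.continuous_onsagerSymbol`, kept private so that this file does not import
the transfer-matrix chain). [folklore] -/
private theorem continuous_onsagerSymbol_aux {β : ℝ} (hβ : 0 < β) (hβc : β ≠ criticalBetaTwo) :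
    Continuous (onsagerSymbol β) := by
  have hW : Continuous (onsagerW β) := by unfold onsagerW; fun_prop
  exact hW.div (Complex.continuous_ofReal.comp hW.norm) fun θ => by
    exact_mod_cast norm_ne_zero_iff.2 (onsagerW_ne_zero hβ hβc θ)

/-- The bases `1 - γ₁z`, `1 - z/γ₂` stay in the right half plane on a disc of radius `R > 1`
(`R = 2/(1+a)`, `a = max(γ₁, γ₂⁻¹) < 1`). [folklore] -/
theorem re_one_sub_mul_pos_of_norm_le {γ a R : ℝ} (hγ0 : 0 ≤ γ) (hγa : γ ≤ a) (hRa : a * R < 1)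
    {z : ℂ} (hz : ‖z‖ ≤ R) : 0 < (1 - (γ : ℂ) * z).re := by
  have h1 : ((γ : ℂ) * z).re ≤ γ * R := by
    refine (Complex.re_le_norm _).trans ?_
    rw [norm_mul, Complex.norm_real, Real.norm_of_nonneg hγ0]
    exact mul_le_mul_of_nonneg_left hz hγ0
  have h2 : γ * R ≤ a * R := by
    rcases le_or_gt 0 R with hR | hR
    · exact mul_le_mul_of_nonneg_right hγa hR
    · linarith [hz, norm_nonneg z]
  simp only [Complex.sub_re, Complex.one_re]
  linarith

/-- **Wu 1966 (weak form), proved**: for `0 < β < β_c(2)` the Toeplitz determinants of Onsager's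
symbol decay exponentially, `|D_k(φ_β)| ≤ C e^{-ck}` — the discharge of the named fact
`toeplitzDet_onsagerSymbol_exp_decay` (T. T. Wu, Phys. Rev. 149 (1966) 380, `T > T_c`;
Deift–Its–Krasovsky 2013, §5, eq. (64)). The printed asymptotics are sharper
(`(πk)^{-1/2} γ₂^{-k}(…)(1 + O(1/k))`); here any rate `c < log min(γ₁⁻¹, γ₂)` is obtained from the
factorization `onsagerSymbol_eq_factorization` and `toeplitzDet_exp_decay_of_factorization`. [cite: Wu1966, T > T_c asymptotics of D_n(φ_Onsager) (= DeiftItsKrasovsky2013 §5 eq. (64))] -/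
theorem toeplitzDet_onsagerSymbol_exp_decay_holds : toeplitzDet_onsagerSymbol_exp_decay := by
  intro β hβ0 hβc
  have hγ₁0 := onsagerGammaOne_pos hβ0
  have hγ₁1 := onsagerGammaOne_lt_one hβ0
  have hγ₂1 : 1 < onsagerGammaTwo β := (one_lt_onsagerGammaTwo_iff hβ0).2 hβc
  have hγ₂0 : 0 < onsagerGammaTwo β := one_pos.trans hγ₂1
  set γ₁ := onsagerGammaOne β with hγ₁
  set γ₂ := onsagerGammaTwo β with hγ₂
  have hi0 : 0 < γ₂⁻¹ := inv_pos.2 hγ₂0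
  have hi1 : γ₂⁻¹ < 1 := inv_lt_one_of_one_lt₀ hγ₂1
  -- the radius
  set a := max γ₁ γ₂⁻¹ with ha
  have ha0 : 0 < a := lt_max_of_lt_left hγ₁0
  have ha1 : a < 1 := max_lt hγ₁1 hi1
  set R : ℝ := 2 / (1 + a) with hR
  have hR1 : 1 < R := by rw [hR, lt_div_iff₀ (by linarith)]; linarith
  have hRa : a * R < 1 := by rw [hR, ← mul_div_assoc, div_lt_one (by linarith)]; linarith
  have hR0 : 0 < R := one_pos.trans hR1
  -- the bases stay in the slit plane on the closed disc of radius `R`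
  have hb1 : ∀ z ∈ Metric.closedBall (0 : ℂ) R, (1 - (γ₁ : ℂ) * z) ∈ Complex.slitPlane :=
    fun z hz => Complex.mem_slitPlane_iff.2 (Or.inl (re_one_sub_mul_pos_of_norm_le hγ₁0.le
      (le_max_left _ _) hRa (mem_closedBall_zero_iff.1 hz)))
  have hb2 : ∀ z ∈ Metric.closedBall (0 : ℂ) R, (1 - (γ₂ : ℂ)⁻¹ * z) ∈ Complex.slitPlane := by
    intro z hz
    have h := re_one_sub_mul_pos_of_norm_le hi0.le (le_max_right _ _) hRa
      (mem_closedBall_zero_iff.1 hz)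
    push_cast at h
    exact Complex.mem_slitPlane_iff.2 (Or.inl h)
  -- `h` and `g`
  have hhd : DifferentiableOn ℂ (fun z : ℂ => (1 - (γ₁ : ℂ) * z) ^ (1 / 2 : ℂ) *
      (1 - (γ₂ : ℂ)⁻¹ * z) ^ (1 / 2 : ℂ)) (Metric.closedBall 0 R) :=
    (DifferentiableOn.cpow_const (by fun_prop) hb1).mul (DifferentiableOn.cpow_const (by fun_prop) hb2)
  have hgd : DifferentiableOn ℂ (fun z : ℂ => (1 - (γ₁ : ℂ) * z) ^ (-(1 / 2) : ℂ) *
      (1 - (γ₂ : ℂ)⁻¹ * z) ^ (-(1 / 2) : ℂ)) (Metric.closedBall 0 R) :=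
    (DifferentiableOn.cpow_const (by fun_prop) hb1).mul (DifferentiableOn.cpow_const (by fun_prop) hb2)
  obtain ⟨s, Cs, hs0, hsb, hssum⟩ := exists_hasSum_of_differentiableOn_closedBall hR1 hhd
  obtain ⟨p, Cp, hp0, hpb, hpsum⟩ := exists_hasSum_of_differentiableOn_closedBall hR1 hgd
  simp only [mul_zero, sub_zero, Complex.one_cpow, mul_one] at hs0 hp0
  -- `h g = 1` on the circle
  have hhg : ∀ z : ℂ, ‖z‖ ≤ 1 → (1 - (γ₁ : ℂ) * z) ^ (1 / 2 : ℂ) * (1 - (γ₂ : ℂ)⁻¹ * z) ^ (1 / 2 : ℂ) *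
      ((1 - (γ₁ : ℂ) * z) ^ (-(1 / 2) : ℂ) * (1 - (γ₂ : ℂ)⁻¹ * z) ^ (-(1 / 2) : ℂ)) = 1 := by
    intro z hz
    have hz' : z ∈ Metric.closedBall (0 : ℂ) R := mem_closedBall_zero_iff.2 (hz.trans hR1.le)
    have h1 : (1 - (γ₁ : ℂ) * z) ≠ 0 := Complex.slitPlane_ne_zero (hb1 z hz')
    have h2 : (1 - (γ₂ : ℂ)⁻¹ * z) ≠ 0 := Complex.slitPlane_ne_zero (hb2 z hz')
    have h1' : (1 - (γ₁ : ℂ) * z) ^ (1 / 2 : ℂ) ≠ 0 := by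
      rw [Ne, Complex.cpow_eq_zero_iff]; simp [h1]
    have h2' : (1 - (γ₂ : ℂ)⁻¹ * z) ^ (1 / 2 : ℂ) ≠ 0 := by
      rw [Ne, Complex.cpow_eq_zero_iff]; simp [h2]
    rw [Complex.cpow_neg, Complex.cpow_neg, mul_mul_mul_comm, mul_inv_cancel₀ h1',
      mul_inv_cancel₀ h2', one_mul]
  -- common constants
  set C := max Cs Cp with hC
  have hsC : ∀ x, ‖s x‖ ≤ C * R⁻¹ ^ x := fun x =>
    (hsb x).trans (mul_le_mul_of_nonneg_right (le_max_left _ _) (by positivity))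
  have hpC : ∀ y, ‖p y‖ ≤ C * R⁻¹ ^ y := fun y =>
    (hpb y).trans (mul_le_mul_of_nonneg_right (le_max_right _ _) (by positivity))
  have hσ0 : 0 < R⁻¹ := inv_pos.2 hR0
  have hσ1 : R⁻¹ < 1 := inv_lt_one_of_one_lt₀ hR1
  -- the series on the circle
  have hexp1 : ∀ θ : ℝ, ‖Complex.exp (θ * I)‖ ≤ 1 := fun θ => (Complex.norm_exp_ofReal_mul_I θ).le
  have hexp2 : ∀ θ : ℝ, ‖Complex.exp (-(θ * I))‖ ≤ 1 := fun θ => by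
    rw [show -((θ : ℂ) * I) = ((-θ : ℝ) : ℂ) * I by push_cast; ring]
    exact (Complex.norm_exp_ofReal_mul_I _).le
  have hSp : ∀ θ : ℝ, ∑' x, s x * Complex.exp ((x : ℂ) * θ * I) =
      (1 - (γ₁ : ℂ) * Complex.exp (θ * I)) ^ (1 / 2 : ℂ) *
        (1 - (γ₂ : ℂ)⁻¹ * Complex.exp (θ * I)) ^ (1 / 2 : ℂ) := by
    intro θ
    have h := (hssum _ (hexp1 θ)).tsum_eq
    simp_rw [← Complex.exp_nat_mul, ← mul_assoc] at h
    exact h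
  have hGp : ∀ θ : ℝ, ∑' y, p y * Complex.exp ((y : ℂ) * θ * I) =
      (1 - (γ₁ : ℂ) * Complex.exp (θ * I)) ^ (-(1 / 2) : ℂ) *
        (1 - (γ₂ : ℂ)⁻¹ * Complex.exp (θ * I)) ^ (-(1 / 2) : ℂ) := by
    intro θ
    have h := (hpsum _ (hexp1 θ)).tsum_eq
    simp_rw [← Complex.exp_nat_mul, ← mul_assoc] at h
    exact h
  have hGm : ∀ θ : ℝ, ∑' y, p y * Complex.exp (-((y : ℂ) * θ * I)) =
      (1 - (γ₁ : ℂ) * Complex.exp (-(θ * I))) ^ (-(1 / 2) : ℂ) *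
        (1 - (γ₂ : ℂ)⁻¹ * Complex.exp (-(θ * I))) ^ (-(1 / 2) : ℂ) := by
    intro θ
    have h := (hpsum _ (hexp2 θ)).tsum_eq
    simp_rw [← Complex.exp_nat_mul, mul_neg, ← mul_assoc] at h
    exact h
  -- apply the abstract theorem
  refine toeplitzDet_exp_decay_of_factorization (continuous_onsagerSymbol_aux hβ0 hβc.ne)
    (fun θ => (norm_onsagerSymbol hβ0 hβc.ne θ).le) hσ0 hσ1 hsC hpC hs0 hp0 (fun θ => ?_)
    fun θ => ?_
  · rw [hSp, hGp]
    exact hhg _ (hexp1 θ)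
  · rw [hSp, hGm]
    exact onsagerSymbol_eq_factorization hβ0 hβc θ

end Model

end Literature.Probability.LatticeModels
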